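import Literature.AnabelianGeometry.EtaleTheta.Discharge.Sec5Prop55LeavesOfBiKummerDataGalois
import Literature.AnabelianGeometry.EtaleTheta.Discharge.Sec5Prop55PullRootAndCodOfBiKummerDataGalois
import Literature.AnabelianGeometry.EtaleTheta.Discharge.Sec5Prop55ConnectedBaseOfPullRoot
import Literature.AnabelianGeometry.EtaleTheta.Discharge.Sec5Prop55OfConnectedTemperoidData
import HarnessLib

/-!
# [EtTh] Prop. 5.5 over the genuine connected base with P55-L06c via the root's Kummer cocycle — at `ofBiKummerData` over `B^temp(Π^tp_X)⁰` and at
# `ofConnectedTemperoidData` — ON THE v2 SUBQUOTIENT RECORD `ThetaSubquotientProjGalois` — PROOF-ONLY, proofs verbatim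

S. Mochizuki, *The étale theta function and its Frobenioid-theoretic manifestations*, Publ. RIMS **45** (2009)
[cite: MochizukiEtTh2009, Prop 5.5 p.327–328 (PDF pp.101–102); §5 p.331 (PDF p.105); §5 p.327 (PDF p.101) «these subquotients determine subquotients `Aut_D(D) ↠ Aut^Θ_D(D)`»].
abc-iut cell, layer L2, seat abc-iut-w6-d020 (gen 7), row «(w4-S) V1→V2 PORT — deep EndKnit*/AllLeavesV3*/KummerComparisonInputsLevel*
heads» (abc-iut-L2-lead gen 7 R957; VNEXT-CENSUS-L2 §G5 add. 11 standing row «(w4)»), layer S5a = `Sec5Prop55ConnectedBaseOfPullRoot` (abc-iut-w5-d123) / `Sec5Prop55OfConnectedTemperoidData` (abc-iut-L6-t23).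

WHY.  abc-iut-w5-d123's `cyclotomicRigidity_ofBiKummerData_connectedPart_of_pullRoot` (leaf (G) discharged over the connected base, `hcup` := the pull-root law `hKR`) and
abc-iut-L6-t23's `cyclotomicRigidity_ofConnectedTemperoidData_of_pullRoot` (the same at `ofConnectedTemperoidData`, `hσ`/`hfrac` theorems there) bind
abc-iut-L2-t4's v1 record `(P : ThetaSubquotientProj 𝔉)` asks `proj_surjective` at EVERY base object and is EMPTY at the cell's root model for
`l` odd (abc-iut-L2-t9 p456572, kernel certificate p476337), so there each of these theorems quantifies over an empty type; abc-iut-w6-d079's v2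
record `ThetaSubquotientProjGalois 𝔉 Gal` (p481123; surjectivity only at the objects singled out by `Gal`, as print uses it — Prop. 5.1 / Lemma 5.9
run over connected GALOIS coverings) is INHABITED at every `ofSetting` carrier (p481568) and at every level stub of the junction data (p486065
`RigidData.nonempty_thetaSubquotientProjGalois_of_stub_eq_levelStub`); the v2 clauses `ThetaSubquotientProjGalois.IsKummerDetermined` /
`.CyclotomicRigidity` (p481123 / p484491) and the predicate twins `Thm56Sub.*Gal` (p484491) are the SAME formulas (they read `P` only through
`pre` / `proj` at `Base(B_N)`).

THIS FILE re-keys the listed theorems on the v2 record — binder `{Gal} (P : ThetaSubquotientProjGalois 𝔉 Gal)`, statements otherwise and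
proofs VERBATIM (none of the source arguments uses `proj_surjective`), names = the originals with suffix `_galois`: 
`cyclotomicRigidity_ofBiKummerData_connectedPart_of_pullRoot_galois`, `cyclotomicRigidity_ofConnectedTemperoidData_of_pullRoot_galois` (⊢ `P.CyclotomicRigidity hB`) — consuming
this seat's S1 twins `cyclotomicRigidity_ofBiKummerData_connectedPart_galois`, `hcup_iff_pull_root_mul_galois` BY NAME.
0 `def`s; no v1 file is edited or restated (the `P`-free producers of the sources are consumed BY NAME); the v1 heads are the `P.toGalois Gal`
instances of these twins (abc-iut-w6-d079's `Iff.rfl` bridges `isKummerDetermined_toGalois_iff`, `cyclotomicRigidity_toGalois_iff`, `…Gal_toGalois_iff`).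

HONEST FRAMING: a typing repair of the cell's OWN record (weaker quantifier on `P`, as print uses it); kernel-checked implications between typed
statements over abc-iut-L2-t4's assembled §5 data; every named leaf / binder of the v1 heads stays NAMED exactly as there; nothing of [EtTh]
(a refereed paper) is asserted; the existence of the data for an actual curve is not claimed; typed ≠ discharged; nothing here bears on [IUTchIII]
Cor. 3.12 — no side taken; nothing here asserts abc proved or refuted.
-/

noncomputable section

namespace Literature.AnabelianGeometry.EtaleTheta

open CategoryTheory Opposite FrobenioidCyclotomicRigidity Literature.AlgebraicGeometry.Frobenioids
  Literature.AnabelianGeometry.SemiGraphs Literature.AnabelianGeometry.SemiGraphs.GaloisObjects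

universe u₀ v₀ u v w

namespace ThetaFrobenioid

section FromSec5Prop55ConnectedBaseOfPullRoot

variable {K : Type u₀} [Field K] {X : SemiGraphs.TemperedArithmeticGroup.{u₀} K} {D₀ : Type u₀} [Category.{v₀} D₀]
  {V : FrdIMonoidStub.{w}} {T₀ : RealifiedDivisorMonoids (D₀ := D₀) V}
  {VD : FrdICatStub.{u₀ + 1, u₀, w} (ConnectedPart (BTemp X.Pi))} {S : BiKummerSetting X T₀ (ConnectedPart (BTemp X.Pi)) VD}
  {pullFrac : ∀ {A A' : S.C} (_ : A' ⟶ A), S.biratUnits A → S.biratUnits A'}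
  {lv N : ℕ+} {l' : ℕ} {RD : RigidData.{max u₀ w} N l'} {θ : S.biratUnits S.Aodot} {Bl : S.C}
  {Pl : S.FractionPair θ Bl} {Rl : S.NthRoot θ Pl lv pullFrac}
  (h : ModelFrobenioid.Hypotheses S.tf.divisorMonoid S.tf.ratFnFunctor)
  (toB : ∀ A : S.C, S.biratUnits A →* S.tf.biratUnitsModel A)
  (Q : FrobenioidTheta.ThetaSubquotientStub.{w} (ConnectedPart (BTemp X.Pi)))
  (odd_l : Odd (lv : ℕ)) (R : S.NthRoot Rl.root Rl.pair N pullFrac) (ιX : RD.PiX ≃ₜ* X.Pi)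
  (hopen : IsOpen ((S.galoisSurj R.AN.base R.αData.isGalois).ker : Set X.Pi)) (σ : Aut R.AN.base →* Aut R.AN)
  (K' : Type w) [Field K'] (constEmb : K'ˣ →* S.tf.biratUnitsModel R.BN)
  (constEmb_injective : Function.Injective constEmb)
  (hdivc : ∀ g : Aut R.BN.base,
    ModelFrobenioid.div ((σ ((BiKummerSetting.NthRoot.baseIso S R).conjAut.symm g)).hom ≫ R.pair.num) =
      ModelFrobenioid.div R.pair.num)
  (hdivp : ∀ y : RD.PiYdd,
    ModelFrobenioid.div ((σ (S.galoisSurj R.AN.base R.αData.isGalois (ιX y.1))).hom ≫ R.pair.den) =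
      ModelFrobenioid.div R.pair.den)

variable {Gal : ConnectedPart (BTemp X.Pi) → Prop}

/-- (v2 record `ThetaSubquotientProjGalois`; the v1 theorem `cyclotomicRigidity_ofBiKummerData_connectedPart_of_pullRoot` VERBATIM — binder type + twin names only.) **[EtTh] Proposition 5.5 for the §5 data over the connected base `B^temp(Π^tp_X)⁰` — leaf (G) DISCHARGED, leaf `hcup` := the root's
bi-Kummer Galois-equivariance `hKR`** (composition of `cyclotomicRigidity_ofBiKummerData_connectedPart_galois` with abc-iut-L6-t23's
`hcup_iff_pull_root_mul_galois`): of the three structural leaves of `cyclotomicRigidity_of_laws_galois` only `hproj` stays named.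
[cite: MochizukiEtTh2009, Prop 5.5 p.327–328 (PDF pp.101–102)] -/
theorem cyclotomicRigidity_ofBiKummerData_connectedPart_of_pullRoot_galois
    (hIG : ∀ A : ConnectedPart (BTemp X.Pi), S.IsGaloisObj A → SemiGraphs.IsGaloisObj A.obj)
    (hB : (ofBiKummerData h toB Q odd_l R ιX hopen σ K' constEmb constEmb_injective hdivc hdivp).IsThetaSaturated
      (ofBiKummerData h toB Q odd_l R ιX hopen σ K' constEmb constEmb_injective hdivc hdivp).BN)
    (P : ThetaSubquotientProjGalois (ofBiKummerData h toB Q odd_l R ιX hopen σ K' constEmb constEmb_injective hdivc hdivp) Gal)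
    {η₀ : RD.PiYdd → RD.mu} (hη₀ : η₀ ∈ RD.thetaCocycles)
    (hdies : ∀ k : RD.PiYdd, rhoOfBiKummerData R ιX k = 1 → η₀ k = 1)
    (e : RD.mu → (ofBiKummerData h toB Q odd_l R ιX hopen σ K' constEmb constEmb_injective hdivc hdivp).lDeltaModN
      (ofBiKummerData h toB Q odd_l R ιX hopen σ K' constEmb constEmb_injective hdivc hdivp).BN)
    (he : Function.Surjective e)
    (hlift : ∀ a ∈ (ofBiKummerData h toB Q odd_l R ιX hopen σ K' constEmb constEmb_injective hdivc hdivp).HB,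
      a ∈ P.pre _ → ∃ k : RD.PiYdd, (k : RD.PiX) ∈ RD.lDeltaTheta ∧ rhoOfBiKummerData R ιX k = a)
    (hpre : ∀ k : RD.PiYdd, (k : RD.PiX) ∈ RD.lDeltaTheta → rhoOfBiKummerData R ιX k ∈ P.pre _)
    (hP : ∀ (k : RD.PiYdd) (hk : (k : RD.PiX) ∈ RD.lDeltaTheta) (hm : rhoOfBiKummerData R ιX k ∈ P.pre _),
      (QuotientGroup.mk (P.proj _ ⟨rhoOfBiKummerData R ιX k, hm⟩) :
          (ofBiKummerData h toB Q odd_l R ιX hopen σ K' constEmb constEmb_injective hdivc hdivp).lDeltaModN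
            (ofBiKummerData h toB Q odd_l R ιX hopen σ K' constEmb constEmb_injective hdivc hdivp).BN) =
        e (RD.thetaMod ⟨k, hk⟩))
    (ν : (ofBiKummerData h toB Q odd_l R ιX hopen σ K' constEmb constEmb_injective hdivc hdivp).lDeltaModN
        (ofBiKummerData h toB Q odd_l R ιX hopen σ K' constEmb constEmb_injective hdivc hdivp).BN ≃*
      (ofBiKummerData h toB Q odd_l R ιX hopen σ K' constEmb constEmb_injective hdivc hdivp).muTorsion
        (ofBiKummerData h toB Q odd_l R ιX hopen σ K' constEmb constEmb_injective hdivc hdivp).BN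
        (ofBiKummerData h toB Q odd_l R ιX hopen σ K' constEmb constEmb_injective hdivc hdivp).N)
    (hK : ∀ η : (ofBiKummerData h toB Q odd_l R ιX hopen σ K' constEmb constEmb_injective hdivc hdivp).HB →
        (ofBiKummerData h toB Q odd_l R ιX hopen σ K' constEmb constEmb_injective hdivc hdivp).lDeltaModN
          (ofBiKummerData h toB Q odd_l R ιX hopen σ K' constEmb constEmb_injective hdivc hdivp).BN,
      (∀ k : RD.PiYdd, η ⟨rhoOfBiKummerData R ιX k, Subgroup.mem_map_of_mem _ k.2⟩ = e (η₀ k)) →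
        FrobenioidThetaBiKummer.ThetaPairKummerClass
          (ofBiKummerData h toB Q odd_l R ιX hopen σ K' constEmb constEmb_injective hdivc hdivp) η ν)
    (hσ : ∀ g : Aut R.AN.base, ModelFrobenioid.baseMap (σ g).hom = g.hom)
    (hgeom : P.pre R.BN.base ≤ RD.aug.ker.map (rhoOfBiKummerData R ιX))
    (hconst : ∀ δ ∈ RD.aug.ker, ∀ τ : ModelFrobenioid.units R.BN,
      (S.tf.ratFnFunctor.map (rhoOfBiKummerData R ιX δ).hom.op).hom (ModelFrobenioid.unit τ.1.hom) =
        ModelFrobenioid.unit τ.1.hom)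
    (hreach : LinearlyReachableFromBN
      (ofBiKummerData h toB Q odd_l R ιX hopen σ K' constEmb constEmb_injective hdivc hdivp))
    (hLc : Thm56Sub.LDeltaMapComp
      (ofBiKummerData h toB Q odd_l R ιX hopen σ K' constEmb constEmb_injective hdivc hdivp))
    (hLi : Thm56Sub.LDeltaMapId
      (ofBiKummerData h toB Q odd_l R ιX hopen σ K' constEmb constEmb_injective hdivc hdivp))
    -- the two structural leaves that stay NAMED at the data (laws on the free stub `Q` / `P`, and on `s^⊔-gp`)
    (hproj : ∀ (g g' : Aut ((ofBiKummerData h toB Q odd_l R ιX hopen σ K' constEmb constEmb_injective hdivc hdivp).base.obj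
        (ofBiKummerData h toB Q odd_l R ιX hopen σ K' constEmb constEmb_injective hdivc hdivp).BN))
        (hh : g' ∈ P.pre _), ∃ hgh : g * g' * g⁻¹ ∈ P.pre _,
          (ofBiKummerData h toB Q odd_l R ιX hopen σ K' constEmb constEmb_injective hdivc hdivp).lDeltaMap g.hom
              (P.proj _ ⟨g', hh⟩) = P.proj _ ⟨g * g' * g⁻¹, hgh⟩)
    -- P55-L06c (abc-iut-L6-t23): `hcup` REPLACED by the dictionary law of `toB` and the root's bi-Kummer Galois-equivariance
    (hfrac : ∀ {A B : S.C} (s' s'' : A ⟶ B) (h' : S.IsPreStep s') (h'' : S.IsPreStep s'')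
      (hb : PreFrobenioid.BaseEquivalent S.F s' s''),
      (toB A (S.fracOf s' s'' h' h'' hb) : S.tf.ratFnFunctor.obj (op A.base)) *
        ModelFrobenioid.unit s'' = ModelFrobenioid.unit s')
    (hKR : ∀ (y₀ y : RD.PiX), y ∈ RD.PiYdd → rhoOfBiKummerData R ιX y ∈ P.pre R.BN.base →
        pull S.tf.ratFnFunctor (S.galoisSurj R.AN.base R.αData.isGalois (ιX y)).hom
            (pull S.tf.ratFnFunctor (S.galoisSurj R.AN.base R.αData.isGalois (ιX y₀)).hom
              (toB R.AN R.root : S.tf.ratFnFunctor.obj (op R.AN.base))) *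
            (toB R.AN R.root : S.tf.ratFnFunctor.obj (op R.AN.base)) =
          pull S.tf.ratFnFunctor (S.galoisSurj R.AN.base R.αData.isGalois (ιX y)).hom
              (toB R.AN R.root : S.tf.ratFnFunctor.obj (op R.AN.base)) *
            pull S.tf.ratFnFunctor (S.galoisSurj R.AN.base R.αData.isGalois (ιX y₀)).hom
              (toB R.AN R.root : S.tf.ratFnFunctor.obj (op R.AN.base))) :
    ThetaSubquotientProjGalois.CyclotomicRigidity (𝔉 := ofBiKummerData h toB Q odd_l R ιX hopen σ K' constEmb constEmb_injective hdivc hdivp) P hB :=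
  cyclotomicRigidity_ofBiKummerData_connectedPart_galois h toB Q odd_l R ιX hopen σ K' constEmb constEmb_injective hdivc hdivp hIG hB P hη₀
    hdies e he hlift hpre hP ν hK hσ hgeom hconst hreach hLc hLi hproj
    ((hcup_iff_pull_root_mul_galois h toB Q odd_l R ιX hopen σ K' constEmb constEmb_injective hdivc hdivp hσ hfrac P).mpr hKR)

end FromSec5Prop55ConnectedBaseOfPullRoot

section FromSec5Prop55OfConnectedTemperoidData

variable {K : Type u₀} [Field K] {X : SemiGraphs.TemperedArithmeticGroup.{u₀} K} {D₀ : Type u₀} [Category.{v₀} D₀]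
  {V : FrdIMonoidStub.{w}} {T₀ : RealifiedDivisorMonoids (D₀ := D₀) V}
  {VD : FrdICatStub.{u₀ + 1, u₀, w} (ConnectedPart (BTemp X.Pi))}
  {tf : TemperedFrobenioid T₀ (ConnectedPart (BTemp X.Pi)) VD} {hZ : tf.monoidType = MonoidType.Z}
  {hP : ∀ A : (ConnectedPart (BTemp X.Pi))ᵒᵖ, IsPerfect (tf.Φ.carrier A)}
  {NH : Subgroup (Field.absoluteGaloisGroup K) → tf.category → ℕ+ → Prop} {A₀ : tf.category}
  {hA₀ : PreFrobenioid.IsFrobeniusTrivial tf.toElem A₀} {hA₀' : SemiGraphs.IsGaloisObj A₀.base.obj}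
  {pullFrac : ∀ {A A' : (BiKummerSetting.mkOfConnectedTemperoid X tf hZ hP NH A₀ hA₀ hA₀').C} (_ : A' ⟶ A),
    (BiKummerSetting.mkOfConnectedTemperoid X tf hZ hP NH A₀ hA₀ hA₀').biratUnits A →
      (BiKummerSetting.mkOfConnectedTemperoid X tf hZ hP NH A₀ hA₀ hA₀').biratUnits A'}
  {lv N : ℕ+} {l' : ℕ} {RD : RigidData.{max u₀ w} N l'}
  {θ : (BiKummerSetting.mkOfConnectedTemperoid X tf hZ hP NH A₀ hA₀ hA₀').biratUnits
    (BiKummerSetting.mkOfConnectedTemperoid X tf hZ hP NH A₀ hA₀ hA₀').Aodot}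
  {Bl : (BiKummerSetting.mkOfConnectedTemperoid X tf hZ hP NH A₀ hA₀ hA₀').C}
  {Pl : (BiKummerSetting.mkOfConnectedTemperoid X tf hZ hP NH A₀ hA₀ hA₀').FractionPair θ Bl}
  {Rl : (BiKummerSetting.mkOfConnectedTemperoid X tf hZ hP NH A₀ hA₀ hA₀').NthRoot θ Pl lv pullFrac}
  (h : ModelFrobenioid.Hypotheses tf.divisorMonoid tf.ratFnFunctor)
  (Q : FrobenioidTheta.ThetaSubquotientStub.{w} (ConnectedPart (BTemp X.Pi))) (odd_l : Odd (lv : ℕ))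
  (R : (BiKummerSetting.mkOfConnectedTemperoid X tf hZ hP NH A₀ hA₀ hA₀').NthRoot Rl.root Rl.pair N pullFrac)
  (ιX : RD.PiX ≃ₜ* X.Pi) (K' : Type w) [Field K'] (constEmb : K'ˣ →* tf.biratUnitsModel R.BN)
  (constEmb_injective : Function.Injective constEmb)
  (hinvc : ∀ g : Aut R.AN.base,
    pull tf.divisorMonoid g.hom (ModelFrobenioid.div R.pair.num) = ModelFrobenioid.div R.pair.num)
  (hinvp : ∀ y : RD.PiX, y ∈ RD.PiYdd →
    pull tf.divisorMonoid ((BiKummerSetting.mkOfConnectedTemperoid X tf hZ hP NH A₀ hA₀ hA₀').galoisSurj R.AN.base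
      R.αData.isGalois (ιX y)).hom (ModelFrobenioid.div R.pair.den) = ModelFrobenioid.div R.pair.den)

variable {Gal : ConnectedPart (BTemp X.Pi) → Prop}

/-- (v2 record `ThetaSubquotientProjGalois`; the v1 theorem `cyclotomicRigidity_ofConnectedTemperoidData_of_pullRoot` VERBATIM — binder type + twin names only.) **[EtTh] Proposition 5.5 for the genuine §5 data over `B^temp(Π^tp_X)⁰`** — abc-iut-w4-d099's
`cyclotomicRigidity_ofBiKummerData_connectedPart_of_pullRoot_galois` at `ofConnectedTemperoidData` with `hIG`, `hσ`, `hfrac` DISCHARGED;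
residual binders `hB P hη₀ hdies e he hlift hpre hPproj ν hK hgeom hconst hreach hLc hLi hproj hKR` by name (p427547's `hP` renamed `hPproj` here, `hP` being the perfection input of the setting).
[cite: MochizukiEtTh2009, Prop 5.5 p.327–328 (PDF pp.101–102)] -/
theorem cyclotomicRigidity_ofConnectedTemperoidData_of_pullRoot_galois
    (hB : (ofConnectedTemperoidData h Q odd_l R ιX K' constEmb constEmb_injective hinvc hinvp).IsThetaSaturated
      (ofConnectedTemperoidData h Q odd_l R ιX K' constEmb constEmb_injective hinvc hinvp).BN)
    (P : ThetaSubquotientProjGalois (ofConnectedTemperoidData h Q odd_l R ιX K' constEmb constEmb_injective hinvc hinvp) Gal)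
    {η₀ : RD.PiYdd → RD.mu} (hη₀ : η₀ ∈ RD.thetaCocycles)
    (hdies : ∀ k : RD.PiYdd, rhoOfBiKummerData R ιX k = 1 → η₀ k = 1)
    (e : RD.mu → (ofConnectedTemperoidData h Q odd_l R ιX K' constEmb constEmb_injective hinvc hinvp).lDeltaModN
      (ofConnectedTemperoidData h Q odd_l R ιX K' constEmb constEmb_injective hinvc hinvp).BN)
    (he : Function.Surjective e)
    (hlift : ∀ a ∈ (ofConnectedTemperoidData h Q odd_l R ιX K' constEmb constEmb_injective hinvc hinvp).HB,
      a ∈ P.pre _ → ∃ k : RD.PiYdd, (k : RD.PiX) ∈ RD.lDeltaTheta ∧ rhoOfBiKummerData R ιX k = a)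
    (hpre : ∀ k : RD.PiYdd, (k : RD.PiX) ∈ RD.lDeltaTheta → rhoOfBiKummerData R ιX k ∈ P.pre _)
    (hPproj : ∀ (k : RD.PiYdd) (hk : (k : RD.PiX) ∈ RD.lDeltaTheta) (hm : rhoOfBiKummerData R ιX k ∈ P.pre _),
      (QuotientGroup.mk (P.proj _ ⟨rhoOfBiKummerData R ιX k, hm⟩) :
          (ofConnectedTemperoidData h Q odd_l R ιX K' constEmb constEmb_injective hinvc hinvp).lDeltaModN
            (ofConnectedTemperoidData h Q odd_l R ιX K' constEmb constEmb_injective hinvc hinvp).BN) =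
        e (RD.thetaMod ⟨k, hk⟩))
    (ν : (ofConnectedTemperoidData h Q odd_l R ιX K' constEmb constEmb_injective hinvc hinvp).lDeltaModN
        (ofConnectedTemperoidData h Q odd_l R ιX K' constEmb constEmb_injective hinvc hinvp).BN ≃*
      (ofConnectedTemperoidData h Q odd_l R ιX K' constEmb constEmb_injective hinvc hinvp).muTorsion
        (ofConnectedTemperoidData h Q odd_l R ιX K' constEmb constEmb_injective hinvc hinvp).BN
        (ofConnectedTemperoidData h Q odd_l R ιX K' constEmb constEmb_injective hinvc hinvp).N)
    (hK : ∀ η : (ofConnectedTemperoidData h Q odd_l R ιX K' constEmb constEmb_injective hinvc hinvp).HB →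
        (ofConnectedTemperoidData h Q odd_l R ιX K' constEmb constEmb_injective hinvc hinvp).lDeltaModN
          (ofConnectedTemperoidData h Q odd_l R ιX K' constEmb constEmb_injective hinvc hinvp).BN,
      (∀ k : RD.PiYdd, η ⟨rhoOfBiKummerData R ιX k, Subgroup.mem_map_of_mem _ k.2⟩ = e (η₀ k)) →
        FrobenioidThetaBiKummer.ThetaPairKummerClass
          (ofConnectedTemperoidData h Q odd_l R ιX K' constEmb constEmb_injective hinvc hinvp) η ν)
    (hgeom : P.pre R.BN.base ≤ RD.aug.ker.map (rhoOfBiKummerData R ιX))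
    (hconst : ∀ δ ∈ RD.aug.ker, ∀ τ : ModelFrobenioid.units R.BN,
      (tf.ratFnFunctor.map (rhoOfBiKummerData R ιX δ).hom.op).hom (ModelFrobenioid.unit τ.1.hom) =
        ModelFrobenioid.unit τ.1.hom)
    (hreach : LinearlyReachableFromBN
      (ofConnectedTemperoidData h Q odd_l R ιX K' constEmb constEmb_injective hinvc hinvp))
    (hLc : Thm56Sub.LDeltaMapComp
      (ofConnectedTemperoidData h Q odd_l R ιX K' constEmb constEmb_injective hinvc hinvp))
    (hLi : Thm56Sub.LDeltaMapId
      (ofConnectedTemperoidData h Q odd_l R ιX K' constEmb constEmb_injective hinvc hinvp))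
    -- the two structural leaves that stay NAMED at the data (laws on the free stub `Q` / `P`, and on `s^⊔-gp`)
    (hproj : ∀ (g g' : Aut ((ofConnectedTemperoidData h Q odd_l R ιX K' constEmb constEmb_injective hinvc hinvp).base.obj
        (ofConnectedTemperoidData h Q odd_l R ιX K' constEmb constEmb_injective hinvc hinvp).BN))
        (hh : g' ∈ P.pre _), ∃ hgh : g * g' * g⁻¹ ∈ P.pre _,
          (ofConnectedTemperoidData h Q odd_l R ιX K' constEmb constEmb_injective hinvc hinvp).lDeltaMap g.hom
              (P.proj _ ⟨g', hh⟩) = P.proj _ ⟨g * g' * g⁻¹, hgh⟩)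
    -- P55-L06c (abc-iut-L6-t23): `hcup` REPLACED by the dictionary law of `toB` and the root's bi-Kummer Galois-equivariance
    (hKR : ∀ (y₀ y : RD.PiX), y ∈ RD.PiYdd → rhoOfBiKummerData R ιX y ∈ P.pre R.BN.base →
        pull tf.ratFnFunctor ((BiKummerSetting.mkOfConnectedTemperoid X tf hZ hP NH A₀ hA₀ hA₀').galoisSurj R.AN.base R.αData.isGalois (ιX y)).hom
            (pull tf.ratFnFunctor ((BiKummerSetting.mkOfConnectedTemperoid X tf hZ hP NH A₀ hA₀ hA₀').galoisSurj R.AN.base R.αData.isGalois (ιX y₀)).hom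
              (MonoidHom.id (tf.biratUnitsModel R.AN) R.root : tf.ratFnFunctor.obj (op R.AN.base))) *
            (MonoidHom.id (tf.biratUnitsModel R.AN) R.root : tf.ratFnFunctor.obj (op R.AN.base)) =
          pull tf.ratFnFunctor ((BiKummerSetting.mkOfConnectedTemperoid X tf hZ hP NH A₀ hA₀ hA₀').galoisSurj R.AN.base R.αData.isGalois (ιX y)).hom
              (MonoidHom.id (tf.biratUnitsModel R.AN) R.root : tf.ratFnFunctor.obj (op R.AN.base)) *
            pull tf.ratFnFunctor ((BiKummerSetting.mkOfConnectedTemperoid X tf hZ hP NH A₀ hA₀ hA₀').galoisSurj R.AN.base R.αData.isGalois (ιX y₀)).hom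
              (MonoidHom.id (tf.biratUnitsModel R.AN) R.root : tf.ratFnFunctor.obj (op R.AN.base))) :
    ThetaSubquotientProjGalois.CyclotomicRigidity (𝔉 := ofConnectedTemperoidData h Q odd_l R ιX K' constEmb constEmb_injective hinvc hinvp) P hB := by
  delta ThetaFrobenioid.ofConnectedTemperoidData at hB P e hlift hpre hPproj ν hK hreach hLc hLi hproj ⊢
  exact cyclotomicRigidity_ofBiKummerData_connectedPart_galois
    (S := BiKummerSetting.mkOfConnectedTemperoid X tf hZ hP NH A₀ hA₀ hA₀') (pullFrac := pullFrac) (RD := RD) (θ := θ)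
    (Bl := Bl) (Pl := Pl) (Rl := Rl) h (fun _ => MonoidHom.id _) Q odd_l R ιX
    (BiKummerSetting.mkOfConnectedTemperoid_isOpen_ker_galoisSurj X tf hZ hP NH A₀ hA₀ hA₀' R.AN.base R.αData.isGalois)
    (strvOfBiKummerData h R) K' constEmb constEmb_injective
    (hdivc_of_pull_invariant h.isDivisorial R (strvOfBiKummerData h R) (baseMap_strvOfBiKummerData h R) hinvc)
    (hdivp_of_pull_invariant h.isDivisorial R ιX (strvOfBiKummerData h R) (baseMap_strvOfBiKummerData h R) hinvp)
    (fun _ hA => hA) hB P hη₀ hdies e he hlift hpre hPproj ν hK (baseMap_strvOfBiKummerData h R) hgeom hconst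
    hreach hLc hLi hproj
    ((hcup_iff_pull_root_mul_galois (S := BiKummerSetting.mkOfConnectedTemperoid X tf hZ hP NH A₀ hA₀ hA₀') (pullFrac := pullFrac)
      (T := RD.toThetaEnvData) (θ := θ) (Bl := Bl) (Pl := Pl) (Rl := Rl) h (fun _ => MonoidHom.id _) Q odd_l R ιX
      (BiKummerSetting.mkOfConnectedTemperoid_isOpen_ker_galoisSurj X tf hZ hP NH A₀ hA₀ hA₀' R.AN.base R.αData.isGalois)
      (strvOfBiKummerData h R) K' constEmb constEmb_injective
      (hdivc_of_pull_invariant h.isDivisorial R (strvOfBiKummerData h R) (baseMap_strvOfBiKummerData h R) hinvc)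
      (hdivp_of_pull_invariant h.isDivisorial R ιX (strvOfBiKummerData h R) (baseMap_strvOfBiKummerData h R) hinvp)
      (baseMap_strvOfBiKummerData h R)
      (fun s' s'' _ _ _ => BiKummerSetting.coe_fracOfModel_mul_unit tf T₀.isUnit_BΛ s' s'') P).mpr hKR)

end FromSec5Prop55OfConnectedTemperoidData

end ThetaFrobenioid

end Literature.AnabelianGeometry.EtaleTheta

end
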